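import Summits.CriticalPhenomena.CardyFormulaZ2.Theorems.CardyBoundaryCoulombGasRectilinearCardyWedgeDichotomy

/-!
# Stub `stub_boundaryArmTightness`, geometric input III: the wedge at the junction of a
# rectilinear conformal rectangle
# (line `excursion-kernel-covariance`, crux `RectilinearCardy`, stmt-CriticalPhenomena-5660)

`wedge_at_pt_one`: if the frontier of a conformal rectangle `R` is covered by finitely many
axis-parallel segments (the crux's `IsRectilinear`, unfolded), then near the junction `b = pt 1`
of the arcs `(ab) = arc 0` and `(bc) = arc 1` the frontier consists of these two arcs only, which
are two distinct axis rays from `b`, and the domain is the standard sector of `m ∈ {1, 2, 3}`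
quadrants of the frame `u = (z - b)(-i)^a` swept from one ray to the other (from `arc 0` to `arc 1`
or from `arc 1` to `arc 0`). Assembled from `exists_pos_forall_mem_cross`, `exists_dir_of_mem_cross`,
`exists_mem_Icc_eq_of_norm_le` (part I) and `wedge_dichotomy` (part II).
-/

noncomputable section

open Set Filter Topology MeasureTheory Metric
open Literature.Probability.RandomPlanarGeometry

namespace Summit.CriticalPhenomena.CardyFormulaZ2.Cruxes.RectilinearCardy.ExcursionKernelCovariance

/-- The four axis directions are the powers `i^n`, `n < 4`. [folklore] -/
theorem exists_eq_I_pow {d : ℂ} (hd : d = 1 ∨ d = Complex.I ∨ d = -1 ∨ d = -Complex.I) :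
    ∃ n : ℕ, n < 4 ∧ d = Complex.I ^ n := by
  rcases hd with rfl | rfl | rfl | rfl
  · exact ⟨0, by norm_num, by simp⟩
  · exact ⟨1, by norm_num, by simp⟩
  · exact ⟨2, by norm_num, by simp⟩
  · exact ⟨3, by norm_num, by simp [pow_succ]⟩

/-- `(-i)^(n + 4) = (-i)^n`. [folklore] -/
theorem neg_I_pow_add_four (n : ℕ) : (-Complex.I) ^ (n + 4) = (-Complex.I) ^ n := by
  rw [pow_add, neg_pow Complex.I 4, Complex.I_pow_four]; norm_num

/-- **A straight boundary piece is a ray in its frame.** Let `T ⊆ ℂ` contain `b` and, near `b`,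
consist of `b` and of points `γ t`, `t` in a parameter set on which `γ t = b + ‖γ t - b‖ i^n`;
suppose every point `b + s i^n`, `0 ≤ s < r`, lies in `T`. Then within distance `r` of `b`,
`z ∈ T` iff `(z - b)(-i)^n` is a non-negative real. [folklore] -/
theorem mem_iff_onStart_of_ray {T : Set ℂ} {b : ℂ} {n : ℕ} {r : ℝ} {γ : ℝ → ℂ} {J : Set ℝ}
    (hnear : ∀ z ∈ T, dist z b < r → z = b ∨ ∃ t ∈ J, z = γ t)
    (hdir : ∀ t ∈ J, γ t = b + ((‖γ t - b‖ : ℝ) : ℂ) * Complex.I ^ n)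
    (hfill : ∀ s : ℝ, 0 ≤ s → s < r → b + (s : ℂ) * Complex.I ^ n ∈ T) :
    ∀ z, dist z b < r → (z ∈ T ↔ ((z - b) * (-Complex.I) ^ n).im = 0 ∧
      0 ≤ ((z - b) * (-Complex.I) ^ n).re) := by
  intro z hz
  constructor
  · intro hzT
    rcases hnear z hzT hz with rfl | ⟨t, ht, rfl⟩
    · simp
    · have h : (γ t - b) * (-Complex.I) ^ n = ((‖γ t - b‖ : ℝ) : ℂ) := by
        conv_lhs => rw [hdir t ht]
        rw [add_sub_cancel_left, mul_assoc, I_pow_mul_neg_I_pow, mul_one]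
      rw [h]
      exact ⟨Complex.ofReal_im _, by rw [Complex.ofReal_re]; exact norm_nonneg _⟩
  · rintro ⟨him, hre⟩
    set u := (z - b) * (-Complex.I) ^ n with hu
    have hureal : u = ((u.re : ℝ) : ℂ) := Complex.ext (by simp) (by simp [him])
    have hzu : z = b + ((u.re : ℝ) : ℂ) * Complex.I ^ n := by
      rw [← hureal, hu, mul_assoc, neg_I_pow_mul_I_pow, mul_one, add_sub_cancel]
    have hnorm : u.re < r := by
      have h1 : ‖u‖ = dist z b := by
        rw [hu, norm_mul, norm_pow, norm_neg, Complex.norm_I, one_pow, mul_one, dist_eq_norm]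
      have h2 : ‖u‖ = u.re := by
        rw [hureal, Complex.norm_real, Real.norm_eq_abs, abs_of_nonneg hre, Complex.ofReal_re]
      linarith
    rw [hzu]
    exact hfill u.re hre hnorm

/-- **The wedge at the junction `b = pt 1` of a rectilinear conformal rectangle.** If the frontier
of `R` is covered by finitely many axis-parallel segments, then for some `r > 0`, some frame
exponent `a` and some `m ∈ {1, 2, 3}`: within distance `r` of `b`, the frontier consists of the
arcs `arc 0`, `arc 1` only; the domain is the standard sector of `m` quadrants in the frame
`u = (z - b)(-i)^a`; and the two arcs are the start ray of that frame and the start ray of the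
frame turned by `(-i)^m` — `arc 0` first (sector swept from `(ab)` to `(bc)`) or `arc 1` first.
Proof: near `b` the frontier lies on the cross through `b` (`exists_pos_forall_mem_cross`), the
germs of the two arcs at `b` run along two distinct axis rays (`exists_dir_of_mem_cross`,
injectivity of the boundary loop) and fill them (`exists_mem_Icc_eq_of_norm_le`), the other arcs
and the far parts of `arc 0`, `arc 1` stay away from `b` (compactness, injectivity), and the
domain fills one of the two sectors (`wedge_dichotomy`). [folklore] -/
theorem wedge_at_pt_one (R : ConformalRectangle) {S : Finset (ℂ × ℂ)}
    (hS : ∀ p ∈ S, p.1.re = p.2.re ∨ p.1.im = p.2.im)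
    (hcov : frontier R.carrier ⊆ ⋃ p ∈ S, segment ℝ p.1 p.2) :
    ∃ r : ℝ, 0 < r ∧ ∃ a m : ℕ, (m = 1 ∨ m = 2 ∨ m = 3) ∧
      (∀ z, dist z (R.pt 1) < r → z ∈ frontier R.carrier → z ∈ R.arc 0 ∨ z ∈ R.arc 1) ∧
      (∀ z, dist z (R.pt 1) < r → z ∉ R.arc 2 ∧ z ∉ R.arc 3) ∧
      (∀ z, dist z (R.pt 1) < r → (z ∈ R.carrier ↔
        (m = 1 → 0 < ((z - R.pt 1) * (-Complex.I) ^ a).re ∧ 0 < ((z - R.pt 1) * (-Complex.I) ^ a).im) ∧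
        (m = 2 → 0 < ((z - R.pt 1) * (-Complex.I) ^ a).im) ∧
        (m = 3 → 0 < ((z - R.pt 1) * (-Complex.I) ^ a).im ∨
          ((z - R.pt 1) * (-Complex.I) ^ a).re < 0))) ∧
      ((∀ z, dist z (R.pt 1) < r →
          (z ∈ R.arc 0 ↔ ((z - R.pt 1) * (-Complex.I) ^ a).im = 0 ∧
            0 ≤ ((z - R.pt 1) * (-Complex.I) ^ a).re) ∧
          (z ∈ R.arc 1 ↔ ((z - R.pt 1) * (-Complex.I) ^ (a + m)).im = 0 ∧
            0 ≤ ((z - R.pt 1) * (-Complex.I) ^ (a + m)).re)) ∨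
        (∀ z, dist z (R.pt 1) < r →
          (z ∈ R.arc 1 ↔ ((z - R.pt 1) * (-Complex.I) ^ a).im = 0 ∧
            0 ≤ ((z - R.pt 1) * (-Complex.I) ^ a).re) ∧
          (z ∈ R.arc 0 ↔ ((z - R.pt 1) * (-Complex.I) ^ (a + m)).im = 0 ∧
            0 ≤ ((z - R.pt 1) * (-Complex.I) ^ (a + m)).re))) := by
  set b := R.pt 1 with hb
  set γ := R.boundary with hγ
  have hγc : Continuous γ := R.continuous_boundary
  have hbm : γ (R.mark 1) = b := rfl
  obtain ⟨hm0, h01, h12, h23, hm3⟩ := Literature.Probability.Percolation.mark_chain R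
  have hbf : b ∈ frontier R.carrier := R.pt_mem_frontier 1
  -- injectivity consequences: `γ t = b` only for `t = mark 1` in `[0, 1)`
  have hinj : ∀ t, 0 ≤ t → t < 1 → γ t = b → t = R.mark 1 := fun t ht0 ht1 h =>
    R.injOn_boundary ⟨ht0, ht1⟩ (R.mark_mem 1) h
  -- (A) the cross
  obtain ⟨r₁, hr₁, hcross⟩ := exists_pos_forall_mem_cross hS hcov b
  -- continuity window
  obtain ⟨η₀, hη₀, hη₀r⟩ : ∃ η₀ > 0, ∀ t, |t - R.mark 1| < η₀ → dist (γ t) b < r₁ := by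
    have := Metric.continuousAt_iff.1 (hγc.continuousAt (x := R.mark 1)) r₁ hr₁
    obtain ⟨η₀, hη₀, h⟩ := this
    exact ⟨η₀, hη₀, fun t ht => by rw [← hbm]; exact h (by rwa [Real.dist_eq])⟩
  set η := min η₀ (min (R.mark 1 - R.mark 0) (R.mark 2 - R.mark 1)) / 2 with hηdef
  have hη : 0 < η := by
    rw [hηdef]; refine div_pos (lt_min hη₀ (lt_min (by linarith) (by linarith))) two_pos
  have hηη₀ : η < η₀ := by
    rw [hηdef]
    have := min_le_left η₀ (min (R.mark 1 - R.mark 0) (R.mark 2 - R.mark 1)); linarith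
  have hη1 : η < R.mark 1 - R.mark 0 := by
    rw [hηdef]
    have := (min_le_right η₀ _).trans (min_le_left (R.mark 1 - R.mark 0) (R.mark 2 - R.mark 1))
    linarith
  have hη2 : η < R.mark 2 - R.mark 1 := by
    rw [hηdef]
    have := (min_le_right η₀ _).trans (min_le_right (R.mark 1 - R.mark 0) (R.mark 2 - R.mark 1))
    linarith
  -- (B) directions of the two germs
  have hcrossA : ∀ t ∈ Ioo (R.mark 1 - η) (R.mark 1), (γ t).re = b.re ∨ (γ t).im = b.im :=
    fun t ht => hcross _ (R.boundary_mem_frontier t) (hη₀r t (by rw [abs_lt]; constructor <;>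
      linarith [ht.1, ht.2]))
  have hneA : ∀ t ∈ Ioo (R.mark 1 - η) (R.mark 1), γ t ≠ b := fun t ht h => by
    have := hinj t (by linarith [ht.1]) (by linarith [ht.2]) h; linarith [ht.2]
  have hcrossB : ∀ t ∈ Ioo (R.mark 1) (R.mark 1 + η), (γ t).re = b.re ∨ (γ t).im = b.im :=
    fun t ht => hcross _ (R.boundary_mem_frontier t) (hη₀r t (by rw [abs_lt]; constructor <;>
      linarith [ht.1, ht.2]))
  have hneB : ∀ t ∈ Ioo (R.mark 1) (R.mark 1 + η), γ t ≠ b := fun t ht h => by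
    have := hinj t (by linarith [ht.1]) (by linarith [ht.2]) h; linarith [ht.1]
  obtain ⟨dA, hdA, hdirA⟩ := exists_dir_of_mem_cross hγc hcrossA hneA
  obtain ⟨dB, hdB, hdirB⟩ := exists_dir_of_mem_cross hγc hcrossB hneB
  obtain ⟨a, ha4, rfl⟩ := exists_eq_I_pow hdA
  obtain ⟨a', ha'4, rfl⟩ := exists_eq_I_pow hdB
  -- directions on the closed half-windows
  have hdirA' : ∀ t ∈ Icc (R.mark 1 - η / 2) (R.mark 1),
      γ t = b + ((‖γ t - b‖ : ℝ) : ℂ) * Complex.I ^ a := by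
    intro t ht
    rcases ht.2.eq_or_lt with rfl | hlt
    · rw [hbm]; simp
    · exact hdirA t ⟨by linarith [ht.1], hlt⟩
  have hdirB' : ∀ t ∈ Icc (R.mark 1) (R.mark 1 + η / 2),
      γ t = b + ((‖γ t - b‖ : ℝ) : ℂ) * Complex.I ^ a' := by
    intro t ht
    rcases ht.1.eq_or_lt with rfl | hlt
    · rw [hbm]; simp
    · exact hdirB t ⟨hlt, by linarith [ht.2]⟩
  -- the two radii of the germs
  set ρA := ‖γ (R.mark 1 - η / 2) - b‖ with hρA
  set ρB := ‖γ (R.mark 1 + η / 2) - b‖ with hρB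
  have hρA0 : 0 < ρA := norm_pos_iff.2 (sub_ne_zero.2 (hneA _ ⟨by linarith, by linarith⟩))
  have hρB0 : 0 < ρB := norm_pos_iff.2 (sub_ne_zero.2 (hneB _ ⟨by linarith, by linarith⟩))
  -- filling
  have hfillA : ∀ s : ℝ, 0 ≤ s → s ≤ ρA → b + (s : ℂ) * Complex.I ^ a ∈
      γ '' Icc (R.mark 1 - η / 2) (R.mark 1) := by
    intro s hs0 hs
    obtain ⟨t, ht, hts⟩ := exists_mem_Icc_eq_of_norm_le hγc (by linarith) hdirA' hbm hs0 hs
    exact ⟨t, ht, hts⟩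
  have hfillB : ∀ s : ℝ, 0 ≤ s → s ≤ ρB → b + (s : ℂ) * Complex.I ^ a' ∈
      γ '' Icc (R.mark 1) (R.mark 1 + η / 2) := by
    intro s hs0 hs
    obtain ⟨t, ht, hts⟩ := exists_mem_Icc_eq_of_norm_le' hγc (by linarith) hdirB' hbm hs0 hs
    exact ⟨t, ht, hts⟩
  -- the two directions differ
  have haa' : a ≠ a' := by
    intro h
    subst h
    set s := min ρA ρB with hs
    have hs0 : 0 < s := lt_min hρA0 hρB0
    obtain ⟨t, ht, hts⟩ := hfillA s hs0.le (min_le_left _ _)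
    obtain ⟨t', ht', ht's⟩ := hfillB s hs0.le (min_le_right _ _)
    have heq : t = t' := R.injOn_boundary ⟨by linarith [ht.1], by linarith [ht.2]⟩
      ⟨by linarith [ht'.1], by linarith [ht'.2]⟩ (hts.trans ht's.symm)
    have htm : t = R.mark 1 := le_antisymm ht.2 (heq ▸ ht'.1)
    rw [htm, hbm] at hts
    have : (s : ℂ) * Complex.I ^ a = 0 := by
      have := hts; nth_rewrite 1 [← add_zero b] at this; exact (add_left_cancel this).symm
    rw [mul_eq_zero] at this
    rcases this with h | h
    · exact hs0.ne' (by exact_mod_cast h)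
    · exact (pow_ne_zero a Complex.I_ne_zero) h
  -- the exponent `m`
  set m := (a' + 4 - a) % 4 with hmdef
  have hm4 : m < 4 := Nat.mod_lt _ (by norm_num)
  have hmod : (a + m) % 4 = a' % 4 := by rw [hmdef]; omega
  have hIm : Complex.I ^ (a + m) = Complex.I ^ a' := by
    rw [Complex.I_pow_eq_pow_mod, hmod, ← Complex.I_pow_eq_pow_mod]
  have hnegIm : (-Complex.I) ^ (a + m) = (-Complex.I) ^ a' := by
    have key : ∀ n : ℕ, (-Complex.I) ^ n = (-Complex.I) ^ (n % 4) := fun n => by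
      conv_lhs => rw [← Nat.div_add_mod n 4]
      rw [pow_add, pow_mul, neg_pow Complex.I 4, Complex.I_pow_four]; norm_num
    rw [key, hmod, ← key]
  have hmne : m ≠ 0 := by
    intro h0
    apply haa'
    have h1 : a % 4 = a' % 4 := by rw [← hmod, h0, add_zero]
    rwa [Nat.mod_eq_of_lt ha4, Nat.mod_eq_of_lt ha'4] at h1
  have hm123 : m = 1 ∨ m = 2 ∨ m = 3 := by omega
  -- the far parts of the boundary stay away from `b`
  have hfar : ∀ {u v : ℝ}, 0 ≤ u → v < 1 → R.mark 1 ∉ Icc u v →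
      0 < infDist b (γ '' Icc u v) ∨ Icc u v = ∅ := by
    intro u v hu0 hv1 hm1
    by_cases huv : u ≤ v
    · left
      have hK : IsCompact (γ '' Icc u v) := isCompact_Icc.image hγc
      refine (hK.isClosed.notMem_iff_infDist_pos ((nonempty_Icc.2 huv).image γ)).1 ?_
      rintro ⟨t, ht, htb⟩
      have := hinj t (hu0.trans ht.1) (lt_of_le_of_lt ht.2 hv1) htb
      exact hm1 (this ▸ ht)
    · right; exact Icc_eq_empty huv
  have hfar2 : 0 < infDist b (R.arc 2) := by
    have h2 : R.arc 2 = γ '' Icc (R.mark 2) (R.mark 3) := by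
      show R.boundary '' _ = _; rw [R.nextMark_two]
    rw [h2]
    rcases hfar (u := R.mark 2) (v := R.mark 3) (by linarith) hm3
      (fun h => by linarith [h.1]) with h | h
    · exact h
    · exfalso; rw [Icc_eq_empty_iff] at h; exact h (by linarith)
  have hfar3 : 0 < infDist b (R.arc 3) := by
    have h3 : R.arc 3 = γ '' Icc (R.mark 3) (R.mark 0 + 1) := by
      show R.boundary '' _ = _; rw [R.nextMark_three]
    rw [h3]
    have hK : IsCompact (γ '' Icc (R.mark 3) (R.mark 0 + 1)) := isCompact_Icc.image hγc
    refine (hK.isClosed.notMem_iff_infDist_pos ((nonempty_Icc.2 (by linarith)).image γ)).1 ?_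
    rintro ⟨t, ht, htb⟩
    by_cases ht1 : t < 1
    · have := hinj t (by linarith [ht.1]) ht1 htb; linarith [ht.1]
    · have hper : γ (t - 1) = b := by
        rw [← htb]; conv_rhs => rw [show t = t - 1 + 1 by ring]
        exact (R.periodic_boundary (t - 1)).symm
      have := hinj (t - 1) (by linarith) (by linarith [ht.2]) hper
      linarith [ht.2]
  -- the far parts of `arc 0` and `arc 1`
  have hfarA : ∀ z ∈ γ '' Icc (R.mark 0) (R.mark 1 - η / 2),
      infDist b (γ '' Icc (R.mark 0) (R.mark 1 - η / 2)) ≤ dist z b := fun z hz => by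
    rw [dist_comm]; exact infDist_le_dist_of_mem hz
  have hfarB : ∀ z ∈ γ '' Icc (R.mark 1 + η / 2) (R.mark 2),
      infDist b (γ '' Icc (R.mark 1 + η / 2) (R.mark 2)) ≤ dist z b := fun z hz => by
    rw [dist_comm]; exact infDist_le_dist_of_mem hz
  obtain ⟨r₂, hr₂, hr₂A⟩ : ∃ r₂ : ℝ, 0 < r₂ ∧ ∀ z ∈ γ '' Icc (R.mark 0) (R.mark 1 - η / 2),
      r₂ ≤ dist z b := by
    rcases hfar (u := R.mark 0) (v := R.mark 1 - η / 2) hm0 (by linarith)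
      (fun h => by linarith [h.2]) with h | h
    · exact ⟨_, h, hfarA⟩
    · exact ⟨1, one_pos, fun z hz => by rw [h, image_empty] at hz; exact hz.elim⟩
  obtain ⟨r₃, hr₃, hr₃B⟩ : ∃ r₃ : ℝ, 0 < r₃ ∧ ∀ z ∈ γ '' Icc (R.mark 1 + η / 2) (R.mark 2),
      r₃ ≤ dist z b := by
    rcases hfar (u := R.mark 1 + η / 2) (v := R.mark 2) (by linarith) (by linarith)
      (fun h => by linarith [h.1]) with h | h
    · exact ⟨_, h, hfarB⟩
    · exact ⟨1, one_pos, fun z hz => by rw [h, image_empty] at hz; exact hz.elim⟩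
  -- the radius
  set r := min (min r₁ (min ρA ρB)) (min (min r₂ r₃) (min (infDist b (R.arc 2))
    (infDist b (R.arc 3)))) with hrdef
  have hr : 0 < r := lt_min (lt_min hr₁ (lt_min hρA0 hρB0))
    (lt_min (lt_min hr₂ hr₃) (lt_min hfar2 hfar3))
  have hrr₁ : r ≤ r₁ := (min_le_left _ _).trans (min_le_left _ _)
  have hrρA : r ≤ ρA := (min_le_left _ _).trans ((min_le_right _ _).trans (min_le_left _ _))
  have hrρB : r ≤ ρB := (min_le_left _ _).trans ((min_le_right _ _).trans (min_le_right _ _))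
  have hrr₂ : r ≤ r₂ := (min_le_right _ _).trans ((min_le_left _ _).trans (min_le_left _ _))
  have hrr₃ : r ≤ r₃ := (min_le_right _ _).trans ((min_le_left _ _).trans (min_le_right _ _))
  have hr2 : r ≤ infDist b (R.arc 2) :=
    (min_le_right _ _).trans ((min_le_right _ _).trans (min_le_left _ _))
  have hr3 : r ≤ infDist b (R.arc 3) :=
    (min_le_right _ _).trans ((min_le_right _ _).trans (min_le_right _ _))
  -- (i)-(ii) no other arcs near `b`
  have hno23 : ∀ z, dist z b < r → z ∉ R.arc 2 ∧ z ∉ R.arc 3 := by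
    intro z hz
    constructor
    · intro h; have := infDist_le_dist_of_mem (x := b) h; rw [dist_comm] at this; linarith
    · intro h; have := infDist_le_dist_of_mem (x := b) h; rw [dist_comm] at this; linarith
  have hfront : ∀ z, dist z b < r → z ∈ frontier R.carrier → z ∈ R.arc 0 ∨ z ∈ R.arc 1 := by
    intro z hz hzf
    rw [← R.iUnion_arc_holds] at hzf
    obtain ⟨i, hi⟩ := mem_iUnion.1 hzf
    fin_cases i
    · exact Or.inl hi
    · exact Or.inr hi
    · exact absurd hi (hno23 z hz).1
    · exact absurd hi (hno23 z hz).2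
  -- (iv) `arc 0` is the start ray of the frame `a`
  have hA : ∀ z, dist z b < r → (z ∈ R.arc 0 ↔ ((z - b) * (-Complex.I) ^ a).im = 0 ∧
      0 ≤ ((z - b) * (-Complex.I) ^ a).re) := by
    refine mem_iff_onStart_of_ray (γ := γ) (J := Ioo (R.mark 1 - η) (R.mark 1)) ?_ hdirA ?_
    · intro z hz hzr
      have hz' : z ∈ γ '' Icc (R.mark 0) (R.mark 1) := by
        have : R.arc 0 = γ '' Icc (R.mark 0) (R.mark 1) := by
          show R.boundary '' _ = _; rw [R.nextMark_zero]
        rwa [this] at hz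
      obtain ⟨t, ht, rfl⟩ := hz'
      by_cases htη : t ≤ R.mark 1 - η / 2
      · have := hr₂A (γ t) ⟨t, ⟨ht.1, htη⟩, rfl⟩; linarith
      · rcases ht.2.eq_or_lt with rfl | hlt
        · exact Or.inl hbm
        · exact Or.inr ⟨t, ⟨by push Not at htη; linarith, hlt⟩, rfl⟩
    · intro s hs0 hsr
      obtain ⟨t, ht, hts⟩ := hfillA s hs0 (by linarith)
      refine ⟨t, ⟨by linarith [ht.1], ?_⟩, hts⟩
      rw [R.nextMark_zero]; exact ht.2
  -- (v) `arc 1` is the start ray of the frame `a'`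
  have hB : ∀ z, dist z b < r → (z ∈ R.arc 1 ↔ ((z - b) * (-Complex.I) ^ (a + m)).im = 0 ∧
      0 ≤ ((z - b) * (-Complex.I) ^ (a + m)).re) := by
    rw [hnegIm]
    refine mem_iff_onStart_of_ray (γ := γ) (J := Ioo (R.mark 1) (R.mark 1 + η)) ?_ hdirB ?_
    · intro z hz hzr
      have hz' : z ∈ γ '' Icc (R.mark 1) (R.mark 2) := by
        have : R.arc 1 = γ '' Icc (R.mark 1) (R.mark 2) := by
          show R.boundary '' _ = _; rw [R.nextMark_one]
        rwa [this] at hz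
      obtain ⟨t, ht, rfl⟩ := hz'
      by_cases htη : R.mark 1 + η / 2 ≤ t
      · have := hr₃B (γ t) ⟨t, ⟨htη, ht.2⟩, rfl⟩; linarith
      · rcases ht.1.eq_or_lt with h | hlt
        · exact Or.inl (h ▸ hbm)
        · exact Or.inr ⟨t, ⟨hlt, by push Not at htη; linarith⟩, rfl⟩
    · intro s hs0 hsr
      obtain ⟨t, ht, hts⟩ := hfillB s hs0 (by linarith)
      refine ⟨t, ⟨ht.1, ?_⟩, hts⟩
      rw [R.nextMark_one]; linarith [ht.2]
  -- (vi) the dichotomy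
  have hdich := wedge_dichotomy R.toJordanDomain hbf hr (R.arc_subset_frontier 0)
    (R.arc_subset_frontier 1) (fun z hzf hz => hfront z hz hzf) hm123 hA hB
  rcases hdich with h | h
  · exact ⟨r, hr, a, m, hm123, hfront, hno23, h, Or.inl fun z hz => ⟨hA z hz, hB z hz⟩⟩
  · refine ⟨r, hr, a + m, 4 - m, by omega, hfront, hno23, h, Or.inr fun z hz => ⟨hB z hz, ?_⟩⟩
    rw [show a + m + (4 - m) = a + 4 by omega, neg_I_pow_add_four]
    exact hA z hz

end Summit.CriticalPhenomena.CardyFormulaZ2.Cruxes.RectilinearCardy.ExcursionKernelCovariance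

end
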